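import Summits.HodgeConjecture.HodgeConjecture.Theses.CrLinkCycles
import Summits.HodgeConjecture.HodgeConjecture.Theorems.LimitExtensionDivisorInduction
import Literature.AlgebraicGeometry.HodgeTheory.SupportedHodgeClassesAlgebraic
import Literature.AlgebraicGeometry.HodgeTheory.ComplexGysin
import Literature.AlgebraicTopology.SingularHomology.CupProduct
import HarnessLib

/-!
# Route CrLinkCycles — support item `DivisorIdealLift` (stmt-HodgeConjecture-3355), PROVED:
# `HodgeModels → HodgeModDivisorIdeal → HodgeConjecture`

Card Corollary H of the route: if every rational `(k,k)`-class `c` on every smooth projective complex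
`n`-fold (`k = 1 + p ≤ n`) is `z + d ∪ b` with `z ∈ Algᵏ(X) = algebraicClasses X (1+p)`, `d ∈ Alg¹(X)`
and `b ∈ H^{2p}(X(ℂ); ℂ)` arbitrary (`HodgeModDivisorIdeal`, the route's target), then the Hodge
conjecture holds. The theorem `crLinkCycles_divisorIdealLift_proof` has literally the type of the route
decl `Summit.HodgeConjecture.HodgeConjecture.Theses.CrLinkCycles.DivisorIdealLift`.

Proof (induction on the codimension `k`, for all dimensions at once; every input a THEOREM of the
tree — no definition, no named-fact hypothesis, no sorry):

* `k = 0`: `hodgeConjectureFor_codim_zero`; `k > n`: `H^{2k}(X(ℂ); ℂ) = 0` (`subsingleton_complexBetti`).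
* `1 ≤ k = 1 + p ≤ n`: write `c = z + d ∪ b` (`HodgeModDivisorIdeal` with `q = n - 1 - p`). The class
  `c` is SUPPORTED ON A DIVISOR (`crLinkCycles_cupProduct_mem_supportedClasses_one`: `d ∈ N¹H²` dies off
  a closed `D` of codimension `≥ 1`, hence so does `d ∪ b` by the naturality of the cup product under
  restriction, `cupProduct_map`; and `z ∈ Nᵏ ⊆ N¹`). A rational `(k,k)`-class supported on a divisor of
  the `(n'+1)`-fold `X` is algebraic as soon as the Hodge conjecture holds in codimension `k - 1 = p` for
  all smooth projective `n'`-folds — the closed item `DivisorInduction`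
  (`limitExtension_divisorInduction_proof`: Deligne Hodge III 8.2.7/8.2.8 for snc boundaries, the
  semisimplicity lift of Hodge classes along Gysin maps, push-forward of algebraic classes), which is
  the induction hypothesis. (The rationality descent and the Hodge lift announced in the item's
  docstring are exactly what `DivisorInduction` performs internally.)
* The Hodge-model conjunct is the hypothesis `HodgeModels`.

References: [DeligneHodgeIII1974] Prop. 8.2.7, Cor. 8.2.8; [VoisinHodgeII2003] proof of Prop. 10.26;
[Voisin2025] Cor. 2.12; [Deligne2000] §1; [GrothendieckTopology1969] §1.
-/

noncomputable section

-- every declaration of this problem lives in `Summit.HodgeConjecture.HodgeConjecture.…` (summit = sub-problem)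
set_option linter.dupNamespace false

namespace Summit.HodgeConjecture.HodgeConjecture.Theorems

open CategoryTheory AlgebraicGeometry
open Literature.AlgebraicGeometry Literature.AlgebraicGeometry.Motives Literature.AlgebraicGeometry.HodgeTheory
open Literature.AlgebraicTopology.SingularHomology
open Summit.HodgeConjecture.HodgeConjecture.Theses.CrLinkCycles (HodgeModels HodgeModDivisorIdeal DivisorIdealLift)

/-! ### A product with a divisor-supported class is supported on that divisor -/

/-- **`d ∪ b` is supported on the support of `d`.** For `d ∈ N¹H²(X(ℂ); ℂ) = algebraicClasses X 1`
(a class dying off a Zariski-closed `D` of codimension `≥ 1`) and any `b ∈ H^{2p}(X(ℂ); ℂ)`, the cup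
product `d ∪ b ∈ H^{2(1+p)}(X(ℂ); ℂ)` lies in `N¹H^{2(1+p)}(X(ℂ); ℂ)`: restriction to `(X ∖ D)(ℂ)`
is multiplicative (`cupProduct_map`), so `(d ∪ b)|_{X ∖ D} = d|_{X ∖ D} ∪ b|_{X ∖ D} = 0`.
[cite: GrothendieckTopology1969, §1] [cite: HatcherAT2002, §3.2 Prop. 3.10] -/
theorem crLinkCycles_cupProduct_mem_supportedClasses_one {X : SchemeOver ℂ} {p : ℕ}
    {d : complexBetti X (2 * 1)} (hd : d ∈ algebraicClasses X 1) (b : complexBetti X (2 * p)) :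
    cupProduct (Nat.mul_add 2 1 p).symm d b ∈ supportedClasses X (2 * (1 + p)) 1 := by
  obtain ⟨D, hD, hcod, hd0⟩ := exists_support_of_mem_supportedClasses hd
  refine mem_supportedClasses_of_restrictCompl_eq_zero hD hcod ?_
  change singularCohomology.map ℂ ℂ _ (2 * (1 + p)) (cupProduct (Nat.mul_add 2 1 p).symm d b) = 0
  rw [cupProduct_map]
  change cupProduct (Nat.mul_add 2 1 p).symm (complexBetti.restrictCompl X D (2 * 1) d) _ = 0
  rw [hd0, LinearMap.map_zero₂]

/-- **A class of `HodgeModDivisorIdeal` shape is supported on a divisor**: `z + d ∪ b ∈ N¹H^{2(1+p)}`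
for `z ∈ N^{1+p}H^{2(1+p)} ⊆ N¹` and `d ∈ N¹H²`. [cite: GrothendieckTopology1969, §1] -/
theorem crLinkCycles_add_cupProduct_mem_supportedClasses_one {X : SchemeOver ℂ} {p : ℕ}
    {z : complexBetti X (2 * (1 + p))} (hz : z ∈ algebraicClasses X (1 + p))
    {d : complexBetti X (2 * 1)} (hd : d ∈ algebraicClasses X 1) (b : complexBetti X (2 * p)) :
    z + cupProduct (Nat.mul_add 2 1 p).symm d b ∈ supportedClasses X (2 * (1 + p)) 1 :=
  Submodule.add_mem _ (supportedClasses_mono X (2 * (1 + p)) (by omega : 1 ≤ 1 + p) hz)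
    (crLinkCycles_cupProduct_mem_supportedClasses_one hd b)

/-! ### The induction on the codimension -/

/-- **`HodgeModDivisorIdeal` ⟹ the cycle part of the Hodge conjecture in every codimension.** By
induction on the codimension `k`, simultaneously for all smooth projective complex varieties:
`k = 0` is `hodgeConjectureFor_codim_zero`; for `k = p + 1`, either `k > dim X` and
`H^{2k}(X(ℂ); ℂ) = 0`, or `dim X = 0 < k` likewise, or `1 ≤ k ≤ dim X = n' + 1` and the class is
`z + d ∪ b` (`HodgeModDivisorIdeal`), supported on a divisor
(`crLinkCycles_add_cupProduct_mem_supportedClasses_one`), hence algebraic by the closed item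
`DivisorInduction` (`limitExtension_divisorInduction_proof`) fed with the induction hypothesis in
codimension `p` for `n'`-folds. [cite: DeligneHodgeIII1974, Cor. 8.2.8]
[cite: VoisinHodgeII2003, proof of Prop. 10.26] [cite: Voisin2025, Cor. 2.12] -/
theorem crLinkCycles_mem_algebraicClasses_of_hodgeModDivisorIdeal (hH : HodgeModDivisorIdeal) :
    ∀ (k : ℕ) ⦃n : ℕ⦄ ⦃X : SchemeOver ℂ⦄, IsSmoothProjective n X →
      ∀ c : complexBetti X (2 * k), IsRationalClass c → IsOfHodgeType n X (2 * k) k k c →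
        c ∈ algebraicClasses X k := by
  -- divisor induction (Deligne 8.2.7/8.2.8 + Gysin lift), the closed item `DivisorInduction`
  have hDI := limitExtension_divisorInduction_proof
  unfold Summit.HodgeConjecture.HodgeConjecture.Theses.LimitExtension.DivisorInduction at hDI
  intro k
  induction k with
  | zero => exact fun n X _ c _ _ ↦ hodgeConjectureFor_codim_zero c
  | succ p ihp =>
    intro n X hX c hc hpp
    rcases Nat.lt_or_ge n (p + 1) with hnk | hnk
    · -- codimension above the dimension: no classes
      haveI := subsingleton_complexBetti hX (k := 2 * (p + 1)) (by omega)
      rw [Subsingleton.elim c 0]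
      exact Submodule.zero_mem _
    · -- `1 ≤ p + 1 ≤ n = n' + 1`
      obtain ⟨n', rfl⟩ : ∃ n', n = n' + 1 := ⟨n - 1, by omega⟩
      -- every rational `(p+1, p+1)`-class of `X` is `z + d ∪ b`, supported on a divisor
      have hsupp : ∀ c : complexBetti X (2 * (p + 1)), IsRationalClass c →
          IsOfHodgeType (n' + 1) X (2 * (p + 1)) (p + 1) (p + 1) c →
            c ∈ supportedClasses X (2 * (p + 1)) 1 := by
        rw [Nat.add_comm p 1]
        intro c hc hpp
        obtain ⟨z, hz, d, hd, b, hcb⟩ := hH (n' + 1) X hX p (n' - p) (by omega) c hc hpp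
        rw [hcb]
        exact crLinkCycles_add_cupProduct_mem_supportedClasses_one hz hd b
      -- divisor induction from codimension `p` on `n'`-folds
      exact hDI n' (p + 1) (by omega) (fun Y hY c' hc' hH' ↦ ihp hY c' hc' hH') hX c hc hpp
        (hsupp c hc hpp)

/-! ### The item -/

/-- **Item stmt-HodgeConjecture-3355 (`DivisorIdealLift`, route `CrLinkCycles`), PROVED**:
`HodgeModels → HodgeModDivisorIdeal → HodgeConjecture` — Hodge models supply the anti-vacuity
conjunct, and `HodgeModDivisorIdeal` gives the cycle part in every codimension by induction on the
codimension through divisor induction (`crLinkCycles_mem_algebraicClasses_of_hodgeModDivisorIdeal`).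
The type is literally the route decl `Summit.HodgeConjecture.HodgeConjecture.Theses.CrLinkCycles.DivisorIdealLift`.
[cite: Deligne2000, §1] [cite: DeligneHodgeIII1974, Cor. 8.2.8] [cite: VoisinHodgeII2003, proof of Prop. 10.26] -/
theorem crLinkCycles_divisorIdealLift_proof : DivisorIdealLift := by
  intro hM hH n X hX
  exact ⟨(hM n X).nonempty hX,
    fun p c hc hpp ↦ crLinkCycles_mem_algebraicClasses_of_hodgeModDivisorIdeal hH p hX c hc hpp⟩

/-- **`HodgeModDivisorIdeal` ⟹ `HodgeConjecture`, unconditionally in the Hodge models** (the route's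
target decides the summit: `HodgeModels` is the theorem `HodgeModels_holds`).
[cite: Deligne2000, §1] [cite: DeligneHodgeIII1974, Cor. 8.2.8] -/
theorem crLinkCycles_hodgeConjecture_of_hodgeModDivisorIdeal (hH : HodgeModDivisorIdeal) :
    _root_.HodgeConjecture :=
  crLinkCycles_divisorIdealLift_proof Summit.HodgeConjecture.HodgeConjecture.Theses.CrLinkCycles.HodgeModels_holds hH

end Summit.HodgeConjecture.HodgeConjecture.Theorems

end
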